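import Summits.ABC.StewartYu.PadicG3SatNPackB
import Summits.ABC.StewartYu.PadicG3ParOddN
import Summits.ABC.StewartYu.PadicG3ParNG
import HarnessLib

/-!
# Cell abc-stewartyu, WP-L.P(odd) (crux r3 `PadicCoreOddRat`, stmt-ABC-20503): the STATIC half of the record package —
# the record `parOddN` of a saturated datum on the budget letter `W̃ = W + log N + log n! + 4 log n`, its field equations,
# the two coefficient floors and the END record at the datum

`Summits/ABC/StewartYu/PadicG3SatNStatic.lean` — cell `abc-stewartyu` (seat p2-g7, line lead of `sat-odd`; record constructor p1's
`parOddN`, END record p1's `PadicG3ParN.recordOddN_datumW`).  Proofs only; no definition, no named fact.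
Of the seventeen conjuncts of the record package `hR` of `G3Setup.recordSupplyOddSatRD_of_package'` (`PadicG3SatNPackB`), eleven do not
involve the budget: the field equations `p, K₀ = p − 1, gⁿ ≤ K, θ₀ = ½, N_q = K ≥ 2, N = F.N, A = V`, the floors
`log N + log n! + 3 log n ≤ P.W` and `log(n·(n!·N)) + W ≤ P.W`, and `RecordOdd (c^·) p n V Vmax W D₀N S₀NV (XfinOS (schedN 1)) DN`.
This file discharges them ONCE, for the record `P := parOddN p … V Vmax W̃ … N …` on the letter `W̃ := W + log N + log n! + 4·log n`
(`N ≤ ∏ⱼ 2Vⱼ/log 2 = (2/log 2)ⁿ·∏V` gives the field `hNΩ`; `log N ≤ W̃` the field `hNW`), and records the side facts the budget half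
consumes (`P.W = W̃`, `Amax ≤ Vmax`, `Amax ≤ 2ⁿΩ`, `3 ≤ p`, `p − 1 ≤ K₀`).
* `prod_two_mul_div_log_two` (`∏ⱼ 2Vⱼ/log 2 = (2/log 2)ⁿ·∏ⱼ Vⱼ`), `G3Setup.exists_parOddN_static`.

References: Yu. V. Nesterenko, LNM 1819 (2003) §3.4 Prop 3.7, §3.5 (3.24), §5.2 (shape only); K. Yu, Acta Math. 211 (2013) §7.
-/

noncomputable section

open Finset Real
open Summit.ABC.StewartYu.GenThreeFrameSpecOdd (RecordOdd)

namespace Summit.ABC.StewartYu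

/-- `∏ⱼ (2·Vⱼ/log 2) = (2/log 2)ⁿ · ∏ⱼ Vⱼ`. [folklore] -/
theorem prod_two_mul_div_log_two {n : ℕ} (V : Fin n → ℝ) :
    ∏ j, (2 * V j / Real.log 2) = (2 / Real.log 2) ^ n * ∏ j, V j := by
  have e : ∀ j, 2 * V j / Real.log 2 = (2 / Real.log 2) * V j := fun j => by ring
  simp_rw [e]
  rw [Finset.prod_mul_distrib, Finset.prod_const, Finset.card_univ, Fintype.card_fin]

namespace G3Setup

variable {p : ℕ} [Fact p.Prime] (S : G3Setup p)

/-- **THE STATIC HALF OF THE RECORD PACKAGE.**  For a saturated datum `(F, V, Vmax, W)` (`1 ≤ Vⱼ ≤ Vmax`, `1 ≤ W`, `N ≤ ∏ⱼ 2Vⱼ/log 2`)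
the record `P := parOddN p … V Vmax W̃ … N …` on `W̃ := W + log N + log n! + 4 log n` has: `P.p = p`, `K₀ = p − 1`, `gⁿ ≤ K`, `θ₀ = ½`,
`N_q = K`, `2 ≤ K`, `P.N = N`, `P.A = V`, `P.W = W̃`, `Amax ≤ Vmax`, `Amax ≤ 2ⁿΩ`, `3 ≤ p`, `p − 1 ≤ K₀`, the two coefficient floors of the
package, and `RecordOdd (c^·) p n V Vmax W D₀N S₀NV (XfinOS (schedN 1)) DN` for every `c ≥ 256`.
[cite: Nesterenko2003, §5.2 (5.12)–(5.22); shape only] -/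
theorem exists_parOddN_static (hn1 : 1 ≤ S.n) (F : S.SatData) (V : Fin S.n → ℝ) (Vmax W : ℝ)
    (hV1 : ∀ j, 1 ≤ V j) (hVm : ∀ j, V j ≤ Vmax) (hW1 : 1 ≤ W)
    (hNV : (F.N : ℝ) ≤ ∏ j, (2 * V j / Real.log 2)) :
    ∃ P : PadicG3ParN S.n, P.p = p ∧ P.K₀ = p - 1 ∧ P.g ^ S.n ≤ (P.K : ℝ) ∧ P.θ₀ = 1 / 2 ∧ P.Nq = P.K ∧ 2 ≤ P.K ∧
      P.N = F.N ∧ P.A = V ∧ P.W = W + Real.log F.N + Real.log S.n.factorial + 4 * Real.log S.n ∧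
      P.Amax ≤ Vmax ∧ P.Amax ≤ 2 ^ S.n * P.Ω ∧ 3 ≤ P.p ∧ ((P.p : ℝ) - 1 ≤ P.K₀) ∧
      Real.log F.N + Real.log S.n.factorial + 3 * Real.log S.n ≤ P.W ∧
      Real.log ((S.n : ℝ) * ((S.n.factorial * F.N : ℕ) : ℝ)) + W ≤ P.W ∧
      (∀ c : ℝ, 256 ≤ c → RecordOdd (fun m => c ^ m) p S.n V Vmax W P.D0N P.S0NV (S.XfinOS (P.schedN 1)) P.DN) := by
  have hp3 : 3 ≤ p := S.hp3
  have hNpos : (0 : ℝ) < F.N := by exact_mod_cast F.hN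
  have hN1 : (1 : ℝ) ≤ F.N := by exact_mod_cast F.hN
  have hnR : (1 : ℝ) ≤ S.n := by exact_mod_cast hn1
  have hfa : (1 : ℝ) ≤ S.n.factorial := by exact_mod_cast S.n.factorial_pos
  have hlogN : 0 ≤ Real.log F.N := Real.log_nonneg hN1
  have hlogn : 0 ≤ Real.log S.n := Real.log_nonneg hnR
  have hlogfa : 0 ≤ Real.log S.n.factorial := Real.log_nonneg hfa
  -- the budget letter
  set Wt : ℝ := W + Real.log F.N + Real.log S.n.factorial + 4 * Real.log S.n with hWt
  have hWt1 : 1 ≤ Wt := by rw [hWt]; linarith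
  have hNW : Real.log F.N ≤ Wt := by rw [hWt]; linarith
  have hNΩ : (F.N : ℝ) ≤ (2 / Real.log 2) ^ S.n * ∏ j, V j := by rw [← prod_two_mul_div_log_two]; exact hNV
  -- the record
  set P : PadicG3ParN S.n := parOddN p hp3 hn1 V Vmax Wt hV1 hVm hWt1 F.N F.hN hNΩ hNW with hP
  have hPp : P.p = p := rfl
  have hPA : P.A = V := rfl
  have hPW : P.W = Wt := rfl
  have hPN : P.N = F.N := rfl
  have hK₀ : P.K₀ = p - 1 := rfl
  have hθ : P.θ₀ = 1 / 2 := rfl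
  have hNq : P.Nq = P.K := parOddN.Nq_eq_K p hp3 hn1 V Vmax Wt hV1 hVm hWt1 F.N F.hN hNΩ hNW
  have hK2 : 2 ≤ P.K := parOddN.two_le_K p hp3 hn1 V Vmax Wt hV1 hVm hWt1 F.N F.hN hNΩ hNW
  have hgK : P.g ^ S.n ≤ (P.K : ℝ) := parOddN.pow_g_le_K' p hp3 hn1 V Vmax Wt hV1 hVm hWt1 F.N F.hN hNΩ hNW
  have hAmaxV : P.Amax ≤ Vmax := parOddN.Amax_le_Vmax p hp3 hn1 V Vmax Wt hV1 hVm hWt1 F.N F.hN hNΩ hNW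
  have hAmaxΩ : P.Amax ≤ 2 ^ S.n * P.Ω := parOddN.Amax_le_two_pow_Ω p hp3 hn1 V Vmax Wt hV1 hVm hWt1 F.N F.hN hNΩ hNW
  have hp3P : 3 ≤ P.p := hp3
  have hK₀ge : (P.p : ℝ) - 1 ≤ P.K₀ := parOddN.K₀_ge p hp3 hn1 V Vmax Wt hV1 hVm hWt1 F.N F.hN hNΩ hNW
  have hA1 : ∀ j, 1 ≤ P.A j := fun j => by rw [hPA]; exact hV1 j
  have hθle : (1 / 2 : ℝ) ≤ P.θ₀ := by rw [hθ]
  refine ⟨P, hPp, hK₀, hgK, hθ, hNq, hK2, hPN, hPA, hPW, hAmaxV, hAmaxΩ, hp3P, hK₀ge, ?_, ?_, ?_⟩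
  · -- `log N + log n! + 3 log n ≤ W̃`
    rw [hPW, hWt]; linarith
  · -- `log(n·(n!·N)) + W ≤ W̃`
    have hsplit : Real.log ((S.n : ℝ) * ((S.n.factorial * F.N : ℕ) : ℝ)) =
        Real.log S.n + Real.log S.n.factorial + Real.log F.N := by
      push_cast
      rw [Real.log_mul (by positivity) (by positivity), Real.log_mul (by positivity) (by positivity)]; ring
    rw [hsplit, hPW, hWt]; linarith
  · -- the END record at the datum `W`
    intro c hc
    have hrec := P.recordOddN_datumW hp3P hK₀ge hNq hθle hAmaxΩ hA1 hAmaxV p hc hW1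
    rw [S.XfinOS_N_eq P 1, ← hPA]
    exact hrec

end G3Setup

end Summit.ABC.StewartYu

end
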